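import Literature.AlgebraicTopology.SingularHomology.LocalisationAdditivity
import Literature.AlgebraicTopology.SingularHomology.FundamentalClassExistence
import Literature.AlgebraicTopology.SingularHomology.LocalHomologyVanishing
import HarnessLib

/-!
# The degree of a map of closed oriented manifolds from one finite good fibre

A. Hatcher, *Algebraic Topology* (2002), §2.2 Prop. 2.30 ("`deg f = Σᵢ deg f|xᵢ`": the degree is the
sum of the local degrees over a finite fibre) and §3.3 Exercise 8 (the same for maps of closed
`R`-oriented `n`-manifolds, `f_* [M] = (deg f) [N]`), in the form with all local degrees `+1`, and
J. Milnor, *Topology from the Differentiable Viewpoint* (1965), §5 (the degree as a count of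
preimages of a regular value). On the tree's carriers (`HomologicalOrientation`, `fundamentalClass`,
`HasDegree μ' μ f d : f_* [X']_{μ'} = d • [X]_μ`, local homology `Hₙ(X | x)` and its localisation at
finite sets, `LocalisationAdditivity`):

* `hasDegree_of_finite_fibre` — let `f : X' → X` be a map of closed `R`-oriented `n`-manifolds, `X`
  connected, and `b ∈ X` a point whose fibre `f⁻¹(b)` is the finite set `{v i}ᵢ` (`v` injective).
  Suppose every `v i` has a "sheet": a space `Y i` with an `R`-orientation class
  `c i ∈ Hₙ(Y i | y i)` and an open embedding `g i : Y i → X'` with `g i (y i) = v i`, whose range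
  contains no other point of the fibre, such that `(g i)_* (c i) = μ'_{v i}` and
  `(f ∘ g i)_* (c i) = μ_b` (maps of pairs `(Y i, Y i ∖ y i) → (X', X' ∖ v i)`, `→ (X, X ∖ b)`).
  Then `f_* [X'] = (#ι) • [X]`, i.e. `HasDegree μ' μ f (Fintype.card ι)`.

Proof: restrict to `b` (`Hₙ(X; R) → Hₙ(X | b; R)` is injective for `X` closed connected, Hatcher
Thm. 3.26 (b), `toLocal_injective_of_connectedSpace_holds`); by naturality the restriction of
`f_* [X']` is `f_*` of the localisation of `[X']` at the fibre `S = f⁻¹(b)`, which is the sum of its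
localisations at the `v i` (`localHomologyOfSet.eq_sum_of_forall_map_eq_restrictLocal`, the classes
on the open sets `range (g i)` being the transported `c i`), and each summand pushes forward to `μ_b`.

Everything is proved; no definitions, no named facts. Consumer: the degree of a generically finite
morphism of smooth projective complex varieties over a finite étale fibre
(`HodgeTheory/ComplexOrientationDegree…`).

## References

* [HatcherAT2002] A. Hatcher, Algebraic Topology, CUP 2002, §2.2 Prop. 2.30, §3.3 Thm. 3.26, Exercise 8.
* [MilnorTDV1965] J. Milnor, Topology from the Differentiable Viewpoint, 1965, §5.
-/

noncomputable section

open CategoryTheory Limits Set Function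

universe u v w

namespace Literature.AlgebraicTopology.SingularHomology

section Degree

variable {R : Type v} [CommRing R] {n : ℕ}
variable {X' X : Type u} [TopologicalSpace X'] [TopologicalSpace X]
  [CompactSpace X'] [T2Space X'] [ChartedSpace (EuclideanSpace ℝ (Fin n)) X']
  [CompactSpace X] [T2Space X] [ChartedSpace (EuclideanSpace ℝ (Fin n)) X] [ConnectedSpace X]

/-- **The degree from one finite good fibre.** Let `f : X' → X` be a map of closed `R`-oriented
`n`-manifolds (`μ'`, `μ`), `X` connected, `b ∈ X` with finite fibre `f⁻¹(b) = {v i}ᵢ`, `v`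
injective. Suppose that for every `i` there are a space `Y i`, a point `y i`, a class
`c i ∈ Hₙ(Y i | y i; R)` and an open embedding `g i : Y i → X'` with `g i (y i) = v i` whose range
misses the other points of the fibre, such that `(g i)_* (c i) = μ'_{v i}` and
`(f ∘ g i)_* (c i) = μ_b`. Then `f_* [X']_{μ'} = (#ι) • [X]_μ` ("`deg f = Σᵢ deg f|xᵢ`" with all
local degrees `+1`). [cite: HatcherAT2002, §2.2 Prop. 2.30 and §3.3 Exercise 8] -/
theorem hasDegree_of_finite_fibre (f : C(X', X)) (μ' : HomologicalOrientation R X' n)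
    (μ : HomologicalOrientation R X n) {ι : Type w} [Fintype ι] {v : ι → X'} (hv : Injective v)
    {b : X} (hfibre : f ⁻¹' {b} = Set.range v)
    {Y : ι → Type u} [∀ i, TopologicalSpace (Y i)] (y : ∀ i, Y i) (g : ∀ i, C(Y i, X'))
    (hg : ∀ i, Topology.IsOpenEmbedding (g i)) (hgy : ∀ i, g i (y i) = v i)
    (hsep : ∀ i l, l ≠ i → v l ∉ Set.range (g i)) (c : ∀ i, localHomology R R (Y i) (y i) n)
    (hgc : ∀ i, relativeSingularHomology.map R R (g i)
      (mapsTo_compl_singleton_of_injective (hg i).injective (hgy i)) n (c i) = μ'.localClass (v i))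
    (hfgc : ∀ i, ∀ (h : MapsTo (f.comp (g i)) ({y i}ᶜ : Set (Y i)) ({b}ᶜ : Set X)),
      relativeSingularHomology.map R R (f.comp (g i)) h n (c i) = μ.localClass b) :
    HasDegree μ' μ f (Fintype.card ι) := by
  classical
  -- the fibre `S` and the map of pairs `(X', X' ∖ S) → (X, X ∖ b)`
  have hS : f ⁻¹' {b} = ⋃ i ∈ (Finset.univ : Finset ι), ({v i} : Set X') := by
    rw [hfibre]
    ext x
    simp only [Set.mem_range, Set.mem_iUnion, Set.mem_singleton_iff, Finset.mem_univ, exists_true_left]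
    exact ⟨fun ⟨i, hi⟩ ↦ ⟨i, hi.symm⟩, fun ⟨i, hi⟩ ↦ ⟨i, hi.symm⟩⟩
  have hf : MapsTo f ((f ⁻¹' {b})ᶜ : Set X') ({b}ᶜ : Set X) := fun x hx hb ↦ hx hb
  -- the open sets `U i = range (g i)` and the transported classes `w i`
  set U : ι → Set X' := fun i ↦ Set.range (g i) with hU
  have hvU : ∀ i, v i ∈ U i := fun i ↦ ⟨y i, hgy i⟩
  -- `g i` as a map onto its range, and the classes `w i ∈ Hₙ(U i | v i)`
  let gr : ∀ i, C(Y i, ↥(U i)) := fun i ↦ ⟨fun z ↦ ⟨g i z, z, rfl⟩, (g i).continuous.subtype_mk _⟩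
  have hgr : ∀ i, MapsTo (gr i) ({y i}ᶜ : Set (Y i)) ({(⟨v i, hvU i⟩ : ↥(U i))}ᶜ : Set ↥(U i)) := by
    intro i z hz hz'
    apply hz
    rw [Set.mem_singleton_iff] at hz' ⊢
    have h1 : g i z = v i := congrArg Subtype.val hz'
    exact (hg i).injective (h1.trans (hgy i).symm)
  set w : ∀ i, relativeSingularHomology R R ↥(U i) {(⟨v i, hvU i⟩ : ↥(U i))}ᶜ n :=
    fun i ↦ relativeSingularHomology.map R R (gr i) (hgr i) n (c i) with hw
  -- `incl ∘ gr i = g i` and `f ∘ incl ∘ gr i = f ∘ g i`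
  have hcomp1 : ∀ i, (subsetIncl (U i)).comp (gr i) = g i := fun i ↦ rfl
  have hcomp2 : ∀ i, (f.comp (subsetIncl (U i))).comp (gr i) = f.comp (g i) := fun i ↦ rfl
  -- the pieces have the prescribed restrictions
  set z : localHomologyOfSet R R X' (f ⁻¹' {b}) n :=
    singularHomology.toLocalOfSet R R X' (f ⁻¹' {b}) n μ'.fundamentalClass with hz
  have hwz : ∀ i, relativeSingularHomology.map R R (subsetIncl (U i))
      (localHomology.mapsTo_subsetIncl_compl (hvU i)) n (w i) =
      restrictLocal R R (localHomologyOfSet.singleton_subset_of_eq_biUnion_singleton hS i) n z := by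
    intro i
    rw [hz, singularHomology.restrictLocal_toLocalOfSet, hw, ← ModuleCat.comp_apply,
      ← relativeSingularHomology.map_comp]
    change relativeSingularHomology.map R R ((subsetIncl (U i)).comp (gr i)) _ n (c i) = _
    rw [relativeSingularHomology.map.congr_simp R R _ _ (hcomp1 i)
      (mapsTo_compl_singleton_of_injective (hg i).injective (hgy i)) n, hgc i]
    exact (HomologicalOrientation.isFundamentalClass_fundamentalClass_holds n μ' (v i)).symm
  have hsum := localHomologyOfSet.eq_sum_of_forall_map_eq_restrictLocal R R hv hvU hsep hS n z w hwz
  -- push forward: each piece goes to `μ_b`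
  have hpush : ∀ i, relativeSingularHomology.map R R f hf n
      (relativeSingularHomology.map R R (subsetIncl (U i))
        (localHomologyOfSet.mapsTo_subsetIncl_compl_of_forall_notMem hS hvU hsep i) n (w i)) =
      μ.localClass b := by
    intro i
    have hm : MapsTo (f.comp (g i)) ({y i}ᶜ : Set (Y i)) ({b}ᶜ : Set X) := by
      intro z hz hz'
      apply hz
      rw [Set.mem_singleton_iff] at hz' ⊢
      have h1 : g i z ∈ f ⁻¹' {b} := hz'
      rw [hfibre] at h1
      obtain ⟨l, hl⟩ := h1
      by_cases hli : l = i
      · subst hli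
        exact (hg l).injective (hl.symm ▸ (hgy l).symm ▸ rfl : g l z = g l (y l)) |> fun h ↦ h
      · exact absurd ⟨z, hl.symm⟩ (hsep i l hli)
    rw [hw, ← ModuleCat.comp_apply, ← ModuleCat.comp_apply, ← relativeSingularHomology.map_comp,
      ← relativeSingularHomology.map_comp]
    change relativeSingularHomology.map R R ((f.comp (subsetIncl (U i))).comp (gr i)) _ n (c i) = _
    rw [relativeSingularHomology.map.congr_simp R R _ _ (hcomp2 i) hm n]
    exact hfgc i hm
  -- conclude at `b`
  rw [HasDegree]
  apply singularHomology.toLocal_injective_of_connectedSpace_holds R R X n b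
  have hnat := relativeSingularHomology.ofAbsolute_comp_map R R f hf n
  have h1 : singularHomology.toLocal R R b n (singularHomology.map R R f n μ'.fundamentalClass) =
      relativeSingularHomology.map R R f hf n z := by
    change (singularHomology.map R R f n ≫ relativeSingularHomology.ofAbsolute R R X {b}ᶜ n)
        μ'.fundamentalClass =
      (relativeSingularHomology.ofAbsolute R R X' (f ⁻¹' {b})ᶜ n ≫ relativeSingularHomology.map R R f hf n)
        μ'.fundamentalClass
    rw [hnat]
  rw [h1, hsum, map_sum, Finset.sum_congr rfl fun i _ ↦ hpush i, Finset.sum_const, Finset.card_univ,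
    map_zsmul, HomologicalOrientation.isFundamentalClass_fundamentalClass_holds n μ b, natCast_zsmul]

end Degree

end Literature.AlgebraicTopology.SingularHomology

end
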